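import Mathlib
import Literature.Computability.Complexity.CliqueTestGraphs

/-!
# Crux `ConvexGateBlind` (stmt-PneNP-10680), line `strict-rank-conic-cover`: definitions + `stub_exponentDown`

(i) The `## Definitions` block of the skeleton `Cruxes/ConvexGateBlind/Lines/strict_rank_conic_cover.lean`, VERBATIM and
in the skeleton's namespace (`Edge`, `cdist`, `ConeFactorisable`, `StrictConeRankHard`), so that every `--supports` file of
the line imports one module for its vocabulary (pattern of `ConvexRankGatesLinAlgGateBlindDefs.lean`). (ii) The registered
stub `stub_exponentDown`: strict cone-rank hardness moves DOWN in the exponent `δ`. Proof: SUBMATRIX MONOTONICITY — for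
`M + p ≤ m`, `D_{M,K}` is literally the submatrix of `D_{m,K+p}` on the rows `padRow Q = ι(Q) ∪ A` (`ι` the initial
segment `Fin M ↪ Fin m`, `A` the `p` APEX vertices `M,…,M+p-1`) and the columns `padCol u` (`u` on the live vertices,
apexes adjacent to everything of index `< M+p`, the rest isolated): `cdist_pad`, `card_padRow`, `cliqueFn_padCol`; cone
factorisations and positive potentials restrict with the same `(q,r)` (`coneFactorisable_pad`). EXPONENT BOOKKEEPING —
`M = ⌊m^{δ'/δ}/2⌋₊`, `K = ⌈M^δ⌉₊ ≤ ⌈m^{δ'}⌉₊ = K + p`, eventually `M + p ≤ m` and `m^c ≤ M^{c'}`, `c' = ⌈(c+1)δ/δ'⌉₊ + 1`;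
hardness at `(M, ⌈M^δ⌉₊)` is pulled back along `M(m) → ∞`. Matrix-level twin of `Disproof.lean` §E.6 `cliqueHard_anti`;
the apexes absorb the slack between the two ceilings, so no discrete intermediate-value step is needed. [folklore]
-/


namespace Summit.PneNP.PneNP.Cruxes.ConvexGateBlind.StrictRankConicCover

open Matrix Finset Filter Literature.Computability.Complexity

noncomputable section

/-! ## Definitions (verbatim from the skeleton `Lines/strict_rank_conic_cover.lean`) -/

/-- Edges of `K_m` — the input positions of `CLIQUE(m, ·)`. -/
abbrev Edge (m : ℕ) : Type := (⊤ : SimpleGraph (Fin m)).edgeSet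

/-- One-sided clique distance `D[Q,u] = #(E(Q) ∖ u)` as a real number — literally the expression of the
canonical form `convexGateBlind_iff_cliqueDistConeRankHard` (Hrubeš's `M_+(CLIQUE)`; entries in `[1, C(k,2)]`
when `#Q = k` and `u` is `k`-clique-free). -/
def cdist {m : ℕ} (Q : Finset (Fin m)) (u : Edge m → Bool) : ℝ :=
  ∑ e, if cliqueVec Q e = true ∧ u e = false then (1 : ℝ) else 0

/-- `ConeFactorisable m k q r a b`: the matrix `D[Q,u] − a(Q)·b(u)` on (`k`-subsets `Q` of `Fin m`) ×
(`k`-clique-free graphs `u`) factorises through the cone `PSD_q × ℝ^r_{≥0}`: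
`D[Q,u] − a(Q) b(u) = tr(H_u Y_Q) + ∑_{l<r} U_{u,l} V_{l,Q}` with `H_u, Y_Q ⪰ 0` (`q × q`) and `U, V ≥ 0`.
(For `a ≡ ε`, `b ≡ 1` this is exactly the factorisation forbidden by the canonical form of the crux.) -/
def ConeFactorisable (m k q r : ℕ) (a : Finset (Fin m) → ℝ) (b : (Edge m → Bool) → ℝ) : Prop :=
  ∃ (H : (Edge m → Bool) → Matrix (Fin q) (Fin q) ℝ) (Y : Finset (Fin m) → Matrix (Fin q) (Fin q) ℝ)
    (U : (Edge m → Bool) → Fin r → ℝ) (V : Fin r → Finset (Fin m) → ℝ),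
    (∀ u, cliqueFn m k u = false → (H u).PosSemidef) ∧
    (∀ Q : Finset (Fin m), Q.card = k → (Y Q).PosSemidef) ∧
    (∀ u l, 0 ≤ U u l) ∧ (∀ l Q, 0 ≤ V l Q) ∧
    ∀ (Q : Finset (Fin m)) (u : Edge m → Bool), Q.card = k → cliqueFn m k u = false →
      cdist Q u - a Q * b u = (H u * Y Q).trace + ∑ l, U u l * V l Q

/-- `StrictConeRankHard m k s` — the `ε`-free (strict-rank) form of the crux at finite size: NO potential
`a ⊗ b` (`a > 0` on `k`-sets, `b > 0` on `k`-clique-free graphs) leaves a `(PSD_q × ℝ^r_{≥0})`-factorisation of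
`D − a ⊗ b` with `q + r ≤ s` (Hrubeš Lemma 16 (ii): the strict cone rank of `D_{m,k}` exceeds `s + 1`). -/
def StrictConeRankHard (m k s : ℕ) : Prop :=
  ∀ q r : ℕ, q + r ≤ s → ∀ (a : Finset (Fin m) → ℝ) (b : (Edge m → Bool) → ℝ),
    (∀ Q : Finset (Fin m), Q.card = k → 0 < a Q) → (∀ u, cliqueFn m k u = false → 0 < b u) →
      ¬ ConeFactorisable m k q r a b

/-! ## Apex / isolated padding: `D_{M,K}` is a submatrix of `D_{m,K+p}` -/

section pad

variable {M m p : ℕ}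

/-- The initial-segment embedding `Fin M ↪ Fin m` of the LIVE vertices (`M + p ≤ m`). [folklore] -/
def liveEmb (h : M + p ≤ m) : Fin M ↪ Fin m := Fin.castLEEmb (by omega)

/-- The `p` APEX vertices `M, …, M + p - 1` of `Fin m`. [folklore] -/
def apexEmb (h : M + p ≤ m) : Fin p ↪ Fin m :=
  ⟨fun i => ⟨M + i.val, by omega⟩, fun i j hij => by
    simp only [Fin.mk.injEq] at hij
    exact Fin.ext (by omega)⟩

/-- The apex set as a `Finset`. [folklore] -/
def apexSet (h : M + p ≤ m) : Finset (Fin m) := (univ : Finset (Fin p)).map (apexEmb h)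

/-- The padded row `ι(Q) ∪ A`. [folklore] -/
def padRow (h : M + p ≤ m) (Q : Finset (Fin M)) : Finset (Fin m) := Q.map (liveEmb h) ∪ apexSet h

/-- The (unsymmetrised) adjacency of the padded column: `u` on live pairs; an apex is adjacent to every vertex of
index `< M + p`. [folklore] -/
def PadRel (u : Edge M → Bool) (x y : Fin m) : Prop :=
  (∃ hx : x.val < M, ∃ hy : y.val < M, (cliqueGraph u).Adj ⟨x.val, hx⟩ ⟨y.val, hy⟩) ∨
    (M ≤ x.val ∧ x.val < M + p ∧ y.val < M + p)

/-- The padded column as a graph on `Fin m` (symmetric closure of `PadRel`, loops removed). [folklore] -/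
def padGraph (p : ℕ) (u : Edge M → Bool) : SimpleGraph (Fin m) := SimpleGraph.fromRel (PadRel (p := p) u)

/-- The padded column as an edge-indicator vector of `K_m`. [folklore] -/
def padCol (p : ℕ) (u : Edge M → Bool) : Edge m → Bool :=
  fun e => @decide ((e : Sym2 (Fin m)) ∈ (padGraph (m := m) p u).edgeSet) (Classical.dec _)

/-- Membership in the apex set. [folklore] -/
theorem mem_apexSet (h : M + p ≤ m) {v : Fin m} : v ∈ apexSet h ↔ M ≤ v.val ∧ v.val < M + p := by
  simp only [apexSet, Finset.mem_map, Finset.mem_univ, true_and, apexEmb, Function.Embedding.coeFn_mk]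
  constructor
  · rintro ⟨i, rfl⟩
    constructor <;> simp
  · rintro ⟨h1, h2⟩
    exact ⟨⟨v.val - M, by omega⟩, Fin.ext (by simp; omega)⟩

/-- Membership in the live image. [folklore] -/
theorem mem_map_liveEmb (h : M + p ≤ m) {Q : Finset (Fin M)} {v : Fin m} :
    v ∈ Q.map (liveEmb h) ↔ ∃ hv : v.val < M, (⟨v.val, hv⟩ : Fin M) ∈ Q := by
  simp only [Finset.mem_map, liveEmb]
  exact ⟨fun ⟨w, hw, hwv⟩ => hwv ▸ ⟨by simp [w.isLt], by simpa using hw⟩,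
    fun ⟨hv, hvQ⟩ => ⟨⟨v.val, hv⟩, hvQ, Fin.ext (by simp)⟩⟩

/-- Membership in a padded row: a live vertex of `Q` or an apex. [folklore] -/
theorem mem_padRow (h : M + p ≤ m) {Q : Finset (Fin M)} {v : Fin m} :
    v ∈ padRow h Q ↔ (∃ hv : v.val < M, (⟨v.val, hv⟩ : Fin M) ∈ Q) ∨ (M ≤ v.val ∧ v.val < M + p) := by
  rw [padRow, Finset.mem_union, mem_map_liveEmb, mem_apexSet]

/-- Vertices of a padded row have index `< M + p`. [folklore] -/
theorem lt_of_mem_padRow (h : M + p ≤ m) {Q : Finset (Fin M)} {v : Fin m} (hv : v ∈ padRow h Q) :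
    v.val < M + p := by
  rcases (mem_padRow h).1 hv with ⟨hv, -⟩ | ⟨-, hv⟩ <;> omega

/-- `#(ι(Q) ∪ A) = #Q + p`. [folklore] -/
theorem card_padRow (h : M + p ≤ m) (Q : Finset (Fin M)) : (padRow h Q).card = Q.card + p := by
  rw [padRow, Finset.card_union_of_disjoint, Finset.card_map, apexSet, Finset.card_map, Finset.card_univ,
    Fintype.card_fin]
  refine Finset.disjoint_left.2 fun v hv hv' => ?_
  obtain ⟨hvM, -⟩ := (mem_map_liveEmb h).1 hv
  have := ((mem_apexSet h).1 hv').1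
  omega

/-- Adjacency in the padded graph. [folklore] -/
theorem padGraph_adj (u : Edge M → Bool) (x y : Fin m) :
    (padGraph (m := m) p u).Adj x y ↔ x ≠ y ∧ (PadRel (p := p) u x y ∨ PadRel (p := p) u y x) := by
  rw [padGraph, SimpleGraph.fromRel_adj]

/-- The padded column on an explicit edge. [folklore] -/
theorem padCol_mk (u : Edge M → Bool) {x y : Fin m} (hxy : s(x, y) ∈ (⊤ : SimpleGraph (Fin m)).edgeSet) :
    padCol (m := m) p u ⟨s(x, y), hxy⟩ = true ↔ (padGraph (m := m) p u).Adj x y := by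
  simp only [padCol, decide_eq_true_eq, SimpleGraph.mem_edgeSet]

/-- The graph of the padded column is the padded graph. [folklore] -/
theorem cliqueGraph_padCol (u : Edge M → Bool) : cliqueGraph (padCol (m := m) p u) = padGraph (m := m) p u := by
  ext x y
  rw [cliqueGraph_adj]
  exact ⟨fun ⟨_, h⟩ => (padCol_mk u _).1 h, fun h => ⟨h.ne, (padCol_mk u _).2 h⟩⟩

/-- Live vertices keep their index. [folklore] -/
@[simp] theorem liveEmb_val (h : M + p ≤ m) (x : Fin M) : (liveEmb h x).val = x.val := rfl

/-- Adjacency of two live vertices in the padded graph is adjacency in `u`. [folklore] -/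
theorem padGraph_adj_live (h : M + p ≤ m) (u : Edge M → Bool) (x y : Fin M) :
    (padGraph (m := m) p u).Adj (liveEmb h x) (liveEmb h y) ↔ (cliqueGraph u).Adj x y := by
  have e1 : ∀ hx, (⟨(liveEmb h x).val, hx⟩ : Fin M) = x := fun _ => Fin.ext (by simp)
  have e2 : ∀ hy, (⟨(liveEmb h y).val, hy⟩ : Fin M) = y := fun _ => Fin.ext (by simp)
  rw [padGraph_adj]
  constructor
  · rintro ⟨-, (⟨hx', hy', hadj⟩ | ⟨hM, -, -⟩) | (⟨hy', hx', hadj⟩ | ⟨hM, -, -⟩)⟩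
    · rwa [e1, e2] at hadj
    · simp at hM; omega
    · rw [e1, e2] at hadj
      exact hadj.symm
    · simp at hM; omega
  · intro hadj
    refine ⟨fun heq => hadj.ne ((liveEmb h).injective heq), Or.inl (Or.inl ⟨by simp [x.isLt], by simp [y.isLt], ?_⟩)⟩
    rwa [e1, e2]

/-- An apex is adjacent to every other vertex of index `< M + p`. [folklore] -/
theorem padGraph_adj_apex (u : Edge M → Bool) {x y : Fin m} (hne : x ≠ y) (hx : M ≤ x.val) (hx' : x.val < M + p)
    (hy : y.val < M + p) : (padGraph (m := m) p u).Adj x y :=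
  (padGraph_adj u x y).2 ⟨hne, Or.inl (Or.inr ⟨hx, hx', hy⟩)⟩

/-- In the padded graph only vertices of index `< M + p` have neighbours. [folklore] -/
theorem lt_of_padGraph_adj (u : Edge M → Bool) {x y : Fin m} (hadj : (padGraph (m := m) p u).Adj x y) :
    x.val < M + p := by
  rcases (padGraph_adj u x y).1 hadj with ⟨-, (⟨hx, -, -⟩ | ⟨-, hx, -⟩) | (⟨-, hx, -⟩ | ⟨-, -, hx⟩)⟩ <;> omega

/-- The edge embedding `E(K_M) ↪ E(K_m)` along the live vertices. [folklore] -/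
def edgeEmb (h : M + p ≤ m) : Edge M ↪ Edge m :=
  ⟨fun e => ⟨(e : Sym2 (Fin M)).map (liveEmb h), by
      obtain ⟨e, he⟩ := e
      induction e using Sym2.ind with
      | h x y =>
        have hxy : x ≠ y := by simpa using he
        simpa using (liveEmb h).injective.ne hxy⟩,
    fun e e' hee' => Subtype.ext (Sym2.map.injective (liveEmb h).injective (congrArg Subtype.val hee'))⟩

/-- **The submatrix identity** `D_{m,K+p}[ι(Q) ∪ A, padCol u] = D_{M,K}[Q,u]`: an edge inside `ι(Q) ∪ A` missing
from the padded column is exactly a live edge of `ι(Q)` missing from `u` (apexes see everything live). [folklore] -/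
theorem cdist_pad (h : M + p ≤ m) (Q : Finset (Fin M)) (u : Edge M → Bool) :
    cdist (padRow h Q) (padCol (m := m) p u) = cdist Q u := by
  classical
  unfold cdist
  -- the summand on `E(K_m)` vanishes off the image of `E(K_M)` …
  rw [← Finset.sum_subset (Finset.subset_univ ((univ : Finset (Edge M)).map (edgeEmb h)))]
  · -- … and agrees with the small summand on the image
    rw [Finset.sum_map]
    refine Finset.sum_congr rfl fun e _ => ?_
    obtain ⟨e, he⟩ := e
    induction e using Sym2.ind with
    | h x y =>
      have hxy : x ≠ y := by simpa using he
      have hQ : cliqueVec (padRow h Q) (edgeEmb h ⟨s(x, y), he⟩) = true ↔ cliqueVec Q ⟨s(x, y), he⟩ = true := by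
        simp only [edgeEmb, Function.Embedding.coeFn_mk, Sym2.map_mk, cliqueVec, Sym2.mem_iff,
          forall_eq_or_imp, forall_eq, decide_eq_true_eq, mem_padRow, liveEmb_val]
        constructor
        · rintro ⟨hx | hx, hy | hy⟩
          · obtain ⟨_, hx⟩ := hx; obtain ⟨_, hy⟩ := hy
            exact ⟨by simpa using hx, by simpa using hy⟩
          all_goals omega
        · rintro ⟨hx, hy⟩
          exact ⟨Or.inl ⟨x.isLt, by simpa using hx⟩, Or.inl ⟨y.isLt, by simpa using hy⟩⟩
      have hu : padCol (m := m) p u (edgeEmb h ⟨s(x, y), he⟩) = false ↔ u ⟨s(x, y), he⟩ = false := by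
        rw [← Bool.not_eq_true, ← Bool.not_eq_true, not_iff_not]
        simp only [edgeEmb, Function.Embedding.coeFn_mk, Sym2.map_mk]
        rw [padCol_mk, padGraph_adj_live, cliqueGraph_adj]
        exact ⟨fun ⟨_, h⟩ => h, fun h => ⟨hxy, h⟩⟩
      simp only [hQ, hu]
  · -- vanishing off the image
    intro e _ hnot
    obtain ⟨e, he⟩ := e
    induction e using Sym2.ind with
    | h x y =>
      have hxy : x ≠ y := by simpa using he
      rw [ite_eq_right_iff]
      rintro ⟨hQ, hcol⟩
      simp only [cliqueVec, Sym2.mem_iff, forall_eq_or_imp, forall_eq, decide_eq_true_eq] at hQ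
      obtain ⟨hxQ, hyQ⟩ := hQ
      have hxL := lt_of_mem_padRow h hxQ
      have hyL := lt_of_mem_padRow h hyQ
      rw [← Bool.not_eq_true, padCol_mk] at hcol
      exfalso
      rcases (mem_padRow h).1 hxQ with ⟨hxM, -⟩ | ⟨hxM, -⟩
      · rcases (mem_padRow h).1 hyQ with ⟨hyM, -⟩ | ⟨hyM, -⟩
        · -- both live: the edge IS in the image
          apply hnot
          refine Finset.mem_map.2 ⟨⟨s(⟨x.val, hxM⟩, ⟨y.val, hyM⟩), by
            simpa [Fin.ext_iff] using hxy⟩, Finset.mem_univ _, Subtype.ext ?_⟩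
          simp only [edgeEmb, Function.Embedding.coeFn_mk, Sym2.map_mk]
          congr 1
        · exact hcol (padGraph_adj_apex (m := m) u (Ne.symm hxy) hyM hyL hxL).symm  -- `y` apex
      · exact hcol (padGraph_adj_apex (m := m) u hxy hxM hxL hyL)  -- `x` apex

/-- **Clique-freeness transfers** (`2 ≤ K`): if `u` is `K`-clique-free then the padded column is
`(K + p)`-clique-free — a clique of size `≥ 2` avoids the isolated vertices, uses at most `p` apexes, and its live
part is a clique of `u`. [folklore] -/
theorem cliqueFn_padCol (h : M + p ≤ m) {K : ℕ} (hK : 2 ≤ K) (u : Edge M → Bool) (hu : cliqueFn M K u = false) :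
    cliqueFn m (K + p) (padCol (m := m) p u) = false := by
  classical
  rw [cliqueFn_eq_false_iff, cliqueGraph_padCol]
  rw [cliqueFn_eq_false_iff] at hu
  rintro S ⟨hclique, hcard⟩
  -- every vertex of `S` has index `< M + p`
  have hlt : ∀ v ∈ S, v.val < M + p := by
    intro v hv
    obtain ⟨w, hw, hwv⟩ := Finset.exists_mem_ne (by omega : 1 < S.card) v
    exact lt_of_padGraph_adj u (hclique hv hw (Ne.symm hwv))
  -- split `S` into live and apex vertices
  set T : Finset (Fin M) := univ.filter fun w => liveEmb h w ∈ S with hT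
  have hTmap : T.map (liveEmb h) = S.filter fun v => v.val < M := by
    ext v
    simp only [Finset.mem_map, Finset.mem_filter, Finset.mem_univ, true_and, hT]
    constructor
    · rintro ⟨w, hw, rfl⟩
      exact ⟨hw, by simp [w.isLt]⟩
    · rintro ⟨hv, hvM⟩
      exact ⟨⟨v.val, hvM⟩, by rwa [show liveEmb h ⟨v.val, hvM⟩ = v from Fin.ext (by simp)], Fin.ext (by simp)⟩
  have hapex : (S.filter fun v => ¬ v.val < M).card ≤ p := by
    calc (S.filter fun v => ¬ v.val < M).card ≤ (apexSet h).card := by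
          refine Finset.card_le_card fun v hv => ?_
          rw [Finset.mem_filter] at hv
          exact (mem_apexSet h).2 ⟨by omega, hlt v hv.1⟩
      _ = p := by rw [apexSet, Finset.card_map, Finset.card_univ, Fintype.card_fin]
  have hTcard : K ≤ T.card := by
    have hsplit := Finset.card_filter_add_card_filter_not (s := S) (fun v : Fin m => v.val < M)
    have : T.card = (S.filter fun v => v.val < M).card := by rw [← hTmap, Finset.card_map]
    omega
  -- the live part is a clique of `u` with at least `K` vertices
  have hTclique : (cliqueGraph u).IsClique (T : Set (Fin M)) := by
    intro w hw w' hw' hne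
    have hwS : liveEmb h w ∈ S := by simpa [hT] using hw
    have hw'S : liveEmb h w' ∈ S := by simpa [hT] using hw'
    exact (padGraph_adj_live h u w w').1 (hclique hwS hw'S fun heq => hne ((liveEmb h).injective heq))
  obtain ⟨T', hT'T, hT'card⟩ := Finset.exists_subset_card_eq hTcard
  exact hu T' ⟨hTclique.subset (by exact_mod_cast hT'T), hT'card⟩

/-- **Submatrix monotonicity of cone factorisations.** A `(PSD_q × ℝ^r_{≥0})`-factorisation of `D_{m,K+p} − a ⊗ b`
restricts along (`padRow`, `padCol`) to one of `D_{M,K} − a' ⊗ b'` with the SAME `(q, r)`, where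
`a' = a ∘ padRow`, `b' = b ∘ padCol` (`M + p ≤ m`, `2 ≤ K`). [folklore] -/
theorem coneFactorisable_pad (h : M + p ≤ m) {K q r : ℕ} (hK : 2 ≤ K) {a : Finset (Fin m) → ℝ}
    {b : (Edge m → Bool) → ℝ} (hf : ConeFactorisable m (K + p) q r a b) :
    ConeFactorisable M K q r (fun Q => a (padRow h Q)) (fun u => b (padCol (m := m) p u)) := by
  obtain ⟨H, Y, U, V, hH, hY, hU, hV, hfact⟩ := hf
  refine ⟨fun u => H (padCol (m := m) p u), fun Q => Y (padRow h Q), fun u l => U (padCol (m := m) p u) l,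
    fun l Q => V l (padRow h Q), fun u hu => hH _ (cliqueFn_padCol h hK u hu),
    fun Q hQ => hY _ (by rw [card_padRow, hQ]), fun u l => hU _ l, fun l Q => hV l _, fun Q u hQ hu => ?_⟩
  have := hfact (padRow h Q) (padCol (m := m) p u) (by rw [card_padRow, hQ]) (cliqueFn_padCol h hK u hu)
  rwa [cdist_pad] at this

end pad

/-! ## Exponent bookkeeping: the stub -/

/-- **stub_exponentDown** (registered stub of line `strict-rank-conic-cover`, crux `ConvexGateBlind`): strict
cone-rank hardness of the clique-distance family propagates DOWNWARD in the exponent — for `0 < δ' ≤ δ < 1`,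
hardness at `k = ⌈m^δ⌉₊` (every `c`, eventually) implies hardness at `k = ⌈m^δ'⌉₊`. Given `m`, compare with
`M = ⌊m^{δ'/δ}/2⌋₊`, `K = ⌈M^δ⌉₊ ≤ ⌈m^{δ'}⌉₊ =: K + p`: eventually `M + p ≤ m` and `m^c ≤ M^{c'}`
(`c' = ⌈(c+1)δ/δ'⌉₊ + 1`), so a potential factorisation of `D_{m,K+p}` of size `≤ m^c` would restrict
(`coneFactorisable_pad`) to one of `D_{M,K}` of size `≤ M^{c'}`, which hardness at `(M, ⌈M^δ⌉₊)` — pulled back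
along `M(m) → ∞` — forbids. [folklore] -/
theorem stub_exponentDown :
    ∀ δ δ' : ℝ, 0 < δ' → δ' ≤ δ → δ < 1 →
      (∀ c : ℕ, ∀ᶠ m : ℕ in atTop, StrictConeRankHard m ⌈(m : ℝ) ^ δ⌉₊ (m ^ c)) →
        ∀ c : ℕ, ∀ᶠ m : ℕ in atTop, StrictConeRankHard m ⌈(m : ℝ) ^ δ'⌉₊ (m ^ c) := by
  intro δ δ' hδ' hδδ hδ1 hhard c
  have hδ0 : 0 < δ := lt_of_lt_of_le hδ' hδδ
  set θ : ℝ := δ' / δ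
  have hθ0 : 0 < θ := div_pos hδ' hδ0
  have hθ1 : θ ≤ 1 := (div_le_one hδ0).2 hδδ
  have hθδ : θ * δ = δ' := div_mul_cancel₀ δ' hδ0.ne'
  -- the comparison size `M(m) = ⌊m^θ/2⌋₊ → ∞` and the new exponent `c'` with `c + 1 ≤ θ c'`
  have hxθ : Tendsto (fun m : ℕ => (m : ℝ) ^ θ) atTop atTop :=
    (tendsto_rpow_atTop hθ0).comp tendsto_natCast_atTop_atTop
  have hMof_tendsto : Tendsto (fun m : ℕ => ⌊(m : ℝ) ^ θ / 2⌋₊) atTop atTop :=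
    tendsto_nat_floor_atTop.comp (hxθ.atTop_div_const (by norm_num : (0 : ℝ) < 2))
  set c' : ℕ := ⌈((c : ℝ) + 1) / θ⌉₊ + 1 with hc'
  have hc'θ : (c : ℝ) + 1 ≤ θ * c' := by
    have h1 : ((c : ℝ) + 1) / θ ≤ ⌈((c : ℝ) + 1) / θ⌉₊ := Nat.le_ceil _
    rw [div_le_iff₀ hθ0] at h1
    rw [show (c' : ℝ) = ⌈((c : ℝ) + 1) / θ⌉₊ + 1 by simp [hc']]
    nlinarith
  have hKtend : Tendsto (fun m : ℕ => ((⌊(m : ℝ) ^ θ / 2⌋₊ : ℕ) : ℝ) ^ δ) atTop atTop :=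
    (tendsto_rpow_atTop hδ0).comp (tendsto_natCast_atTop_atTop.comp hMof_tendsto)
  have hx1 : Tendsto (fun m : ℕ => (m : ℝ) ^ (1 - δ')) atTop atTop :=
    (tendsto_rpow_atTop (by linarith)).comp tendsto_natCast_atTop_atTop
  filter_upwards [hMof_tendsto.eventually (hhard c'), hKtend.eventually_ge_atTop 2,
    hx1.eventually_ge_atTop 4, hxθ.eventually_ge_atTop (4 * 4 ^ c'), eventually_ge_atTop 4]
    with m hhm hK2r h4 hθbig hm4
  set M : ℕ := ⌊(m : ℝ) ^ θ / 2⌋₊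
  set K : ℕ := ⌈(M : ℝ) ^ δ⌉₊
  set k' : ℕ := ⌈(m : ℝ) ^ δ'⌉₊
  have hm0 : (0 : ℝ) ≤ m := Nat.cast_nonneg m
  have hmpos : (0 : ℝ) < m := by exact_mod_cast (show 0 < m by omega)
  have hm1 : (1 : ℝ) ≤ m := by exact_mod_cast (show 1 ≤ m by omega)
  have hxθ0 : (0 : ℝ) ≤ (m : ℝ) ^ θ := by positivity
  have hMle : (M : ℝ) ≤ (m : ℝ) ^ θ / 2 := Nat.floor_le (by positivity)
  have hMge : (m : ℝ) ^ θ / 2 - 1 ≤ M := (Nat.sub_one_lt_floor ((m : ℝ) ^ θ / 2)).le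
  have hθle : (m : ℝ) ^ θ ≤ m := by
    simpa using Real.rpow_le_rpow_of_exponent_le hm1 hθ1
  -- (i) `K ≤ k'`, (ii) `2 ≤ K`, (iii) `M + k' ≤ m`, (iv) `m^c ≤ M^c'`
  have hKk : K ≤ k' := by
    apply Nat.ceil_mono
    calc (M : ℝ) ^ δ ≤ ((m : ℝ) ^ θ) ^ δ := Real.rpow_le_rpow (Nat.cast_nonneg M) (by linarith) hδ0.le
      _ = (m : ℝ) ^ δ' := by rw [← Real.rpow_mul hm0, hθδ]
  have hK2 : 2 ≤ K := by exact_mod_cast hK2r.trans (Nat.le_ceil _)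
  have hpad' : M + k' ≤ m := by
    have hk'le : (k' : ℝ) ≤ (m : ℝ) ^ δ' + 1 := (Nat.ceil_lt_add_one (by positivity)).le
    have hδ'le : (m : ℝ) ^ δ' * 4 ≤ m := by
      calc (m : ℝ) ^ δ' * 4 ≤ (m : ℝ) ^ δ' * (m : ℝ) ^ (1 - δ') := mul_le_mul_of_nonneg_left h4 (by positivity)
        _ = m := by rw [← Real.rpow_add hmpos, show δ' + (1 - δ') = 1 by ring, Real.rpow_one]
    have hm4r : (4 : ℝ) ≤ m := by exact_mod_cast hm4
    exact_mod_cast (show (M : ℝ) + k' ≤ m by linarith)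
  set p : ℕ := k' - K
  have hk'eq : k' = K + p := by omega
  have hpad : M + p ≤ m := by omega
  have hbudget : m ^ c ≤ M ^ c' := by
    have h44 : (1 : ℝ) ≤ 4 ^ c' := one_le_pow₀ (by norm_num)
    have hpos : (0 : ℝ) < 4 ^ c' := by positivity
    have h1 : ((m : ℝ) ^ θ / 4) ^ c' ≤ (M : ℝ) ^ c' := pow_le_pow_left₀ (by positivity) (by linarith) c'
    have h2 : ((m : ℝ) ^ θ / 4) ^ c' = (m : ℝ) ^ (θ * c') / 4 ^ c' := by
      rw [div_pow, ← Real.rpow_natCast ((m : ℝ) ^ θ) c', ← Real.rpow_mul hm0]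
    have h3 : (m : ℝ) ^ ((c : ℝ) + 1) ≤ (m : ℝ) ^ (θ * c') := Real.rpow_le_rpow_of_exponent_le hm1 hc'θ
    have h4' : (m : ℝ) ^ ((c : ℝ) + 1) = m * (m : ℝ) ^ (c : ℝ) := by
      rw [Real.rpow_add hmpos, Real.rpow_one, mul_comm]
    have h5 : (4 : ℝ) ^ c' ≤ m := by linarith
    have hmc0 : (0 : ℝ) ≤ (m : ℝ) ^ (c : ℝ) := by positivity
    have hmain : (m : ℝ) ^ (c : ℝ) ≤ (M : ℝ) ^ c' := by
      calc (m : ℝ) ^ (c : ℝ) ≤ m * (m : ℝ) ^ (c : ℝ) / 4 ^ c' := by rw [le_div_iff₀ hpos]; nlinarith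
        _ = (m : ℝ) ^ ((c : ℝ) + 1) / 4 ^ c' := by rw [h4']
        _ ≤ (m : ℝ) ^ (θ * c') / 4 ^ c' := div_le_div_of_nonneg_right h3 hpos.le
        _ = ((m : ℝ) ^ θ / 4) ^ c' := h2.symm
        _ ≤ (M : ℝ) ^ c' := h1
    have : ((m ^ c : ℕ) : ℝ) ≤ ((M ^ c' : ℕ) : ℝ) := by
      rw [Nat.cast_pow, Nat.cast_pow, ← Real.rpow_natCast (m : ℝ) c]
      exact hmain
    exact_mod_cast this
  -- (v) the transfer along the submatrix embedding
  intro q r hqr a b ha hb hf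
  have hf' : ConeFactorisable m (K + p) q r a b := hk'eq ▸ hf
  refine hhm q r (hqr.trans hbudget) (fun Q => a (padRow hpad Q)) (fun u => b (padCol (m := m) p u))
    (fun Q hQ => ha _ ?_) (fun u hu => hb _ ?_) (coneFactorisable_pad hpad hK2 hf')
  · rw [card_padRow, hQ, hk'eq]
  · rw [hk'eq]
    exact cliqueFn_padCol hpad hK2 u hu

end

end Summit.PneNP.PneNP.Cruxes.ConvexGateBlind.StrictRankConicCover
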